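import Summits.ResolutionOfSingularities.ResolutionOfSingularities.Theorems.FrobeniusClosingSteerWords01Core
import Summits.ResolutionOfSingularities.ResolutionOfSingularities.Theorems.FrobeniusClosingSteerGeoDictShorts
import HarnessLib

/-!
# Crux `Steer` (stmt-ResolutionOfSingularities-16345), line `switching_dichotomy`, F-A1 (α′): the VALUATION-RANK LEMMA —
# a PERSISTENT DIVISOR forces a PROPER COARSENING (composite rank), and its run-side feeders

OURS (campaign `res-hironaka`, rung L ★L-G4, slot W4.1, chain W4.1; seat res-type-038 g21 on chain planner
res-L0-w41-plan-1's RULING 79a (2026-08-27), typing res-L0-w41-idea-3's ANSWER to NOTE 72, item (1); replaces the role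
of no printed item; NOT a statement of the manuscript under review [claim: Hironaka2017, status: under-review]; AI review
is weaker than expert review). Theses-free and definition-free helper for the holder res-L0-w41-lead-1 and the T-line
hands: the T-line binder `¬ SteerRankThinness.HasProperCoarsening O` («no valuation ring strictly between `O` and `K`»,
`Theorems/FrobeniusClosingSteerCore4CompositeRankConcl.lean`, exported through `…Words01Core`) EXCLUDES every run pattern
in which one element `g` of positive value divides one fixed `h ≠ 0` to every power.

## §1 Persistent divisor ⇒ composite rank (pure valuation theory, over Mathlib)

`hasProperCoarsening_of_forall_pow_dvd`: for a valuation subring `O` of a field `K` and `g, h ∈ K` with `g ∈ O`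
NON-ZERO of positive value (`O.valuation g < 1`), `h ≠ 0`, and `h / g ^ k ∈ O` for every `k : ℕ`, the subring
`O[1/g] = {x | ∃ k, g ^ k * x ∈ O}` is a valuation subring of `K` STRICTLY between `O` and `K` (`g⁻¹ ∈ O[1/g] ∖ O`,
`h⁻¹ ∉ O[1/g]`), i.e. `HasProperCoarsening O` (rank `≥ 2`). (idea-3's phrasing: `𝔭 := ⋂ₖ gᵏ·O` is a prime ideal
of `O`, non-zero (`∋ h`) and `≠ 𝔪_O` (`∌ g`); `O[1/g] = O_𝔭`. We build the coarsening directly, so no prime ideal or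
localisation API is needed.) Variants: divisibility inside the ring `O` (`…_of_forall_pow_dvd'`), the value form
`∀ k, v h ≤ (v g) ^ k` (`…_of_forall_valuation_le_pow`), and the two contrapositives under the T-line binder
(`exists_div_pow_not_mem_of_not_hasProperCoarsening`, `exists_pow_valuation_lt_of_not_hasProperCoarsening` — the
archimedean property read off `¬ HasProperCoarsening O` directly, with no `RankOne` structure and no `O ≠ ⊤`).

BINDER NOTE (the dealt shape adapted, RULING 79a «adapt binders to the real def»): the dealt signature had no `g ≠ 0`;
with `g = 0` its hypotheses hold in EVERY valuation ring (`h / 0 ^ k = 0 ∈ O` for `k ≥ 1`), e.g. in `O = K`, which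
has no proper coarsening — `dealtShape_needs_ne_zero` is that witness `(O, g, h) = (⊤, 0, 1)` in the kernel. Hence the
extra binder `(hg0 : g ≠ 0)` (equivalently `0 < O.valuation g`, idea-3's `0 < v g`).

## §2 Run-side feeders (Steer words: members `R i ⊆ O`, centres `P i`, local blowing ups along `O`)

* `hasProperCoarsening_of_forall_div_pow_mem_seq` (plan-1's feeder, RULING 79a): along any sequence of subrings
  `R i ⊆ O` (e.g. the members of a steered run: `IsLocalBlowupAlong O (R i) (P i) (R (i+1))` gives `R i ⊆ O`), if
  `g ∈ O` is non-zero of positive value and ONE FIXED `h ≠ 0` has `h / g ^ k ∈ R (i k)` for every `k`, then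
  `HasProperCoarsening O`; `…_steeredSeq` is the same with `R i ⊆ O` discharged from the blow-up clauses.
* `forall_div_pow_mem_of_persistentDivisor` / `hasProperCoarsening_of_persistentDivisor` (idea-3's feeder): if at the
  stages `j 0 < j 1 < ⋯` ONE element `g` is an exceptional parameter of the blowing up `R (j k) ⊂ R (j k + 1)` along
  `P (j k)` (body of the skeleton's `IsExcParamAlong`: `g ∈ P`, `g ≠ 0`, of maximal `O`-value on `P` — so
  `P · R₁ = g · R₁`, the tree's `GeoDict.exists_mem_mul_of_isExcParamAlong`), `h ∈ R (j 0)`, and the successive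
  quotients `h / g ^ k`, once in `R (j k)`, lie IN THE CENTRE `P (j k)` («the strict transforms of `{h = 0}` pass
  through the centres»), then `h / g ^ k ∈ R (j k)` for all `k` (induction: `P (j k) ⊆ g · R (j k + 1)` and
  `R (j k + 1) ⊆ R (j (k+1))`), hence `HasProperCoarsening O` as soon as `v g > 0`, `h ≠ 0`.
  EXACT RUN-SIDE DATUM this consumes: the membership clause `hcentre` (in values: `v h > k · v g` for all `k`, i.e.
  the composite-rank condition itself — it is a COMBINATORIAL property of the run pattern, e.g. of a tail in which the
  fresh exceptional parameter is never renewed, not a consequence of `CoreDatum`).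

[cite: HeinzerEtAl2015, Remark 2.4] [folklore]
-/

-- `Summit.<S>.<S>.…` duplicates the summit name by design (single-problem summit).
set_option linter.dupNamespace false

open IsLocalRing

namespace Summit.ResolutionOfSingularities.ResolutionOfSingularities.Theorems.SwitchingDichotomy

namespace ValuationRank

open Literature.AlgebraicGeometry.Resolution
open Summit.ResolutionOfSingularities.ResolutionOfSingularities.Theorems.SteerRankThinness (HasProperCoarsening)

universe u

variable {K : Type u} [Field K]

/-! ## §1 Persistent divisor ⇒ proper coarsening -/

/-- **Persistent divisor ⇒ composite rank** (res-L0-w41-idea-3, ANSWER to NOTE 72 (1); RULING 79a's lemma (1) with the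
binder `g ≠ 0` added, see the BINDER NOTE in the module docstring). Let `O` be a valuation subring of `K`, `g ∈ O`
non-zero with `O.valuation g < 1`, `h ≠ 0`, and suppose `h / g ^ k ∈ O` for every `k`. Then `O` has a proper
coarsening: `O[1/g] := {x | ∃ k, g ^ k * x ∈ O}` is a valuation subring with `O ≤ O[1/g]`, `g⁻¹ ∈ O[1/g] ∖ O` and
`h⁻¹ ∉ O[1/g]` (from `g ^ k * h⁻¹ ∈ O` and `h / g ^ (k+1) ∈ O` one would get `g⁻¹ ∈ O`).
[cite: HeinzerEtAl2015, Remark 2.4] [folklore] -/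
theorem hasProperCoarsening_of_forall_pow_dvd (O : ValuationSubring K) {g h : K}
    (hg : g ∈ O ∧ O.valuation g < 1) (hg0 : g ≠ 0) (h0 : h ≠ 0) (hk : ∀ k : ℕ, h / g ^ k ∈ O) :
    HasProperCoarsening O := by
  have hg1 : g⁻¹ ∉ O := (O.mem_nonunits_iff_or.mp (O.mem_nonunits_iff.mpr hg.2)).resolve_left hg0
  -- the coarsening `O[1/g]`
  let O₁ : ValuationSubring K :=
    { carrier := {x | ∃ k : ℕ, g ^ k * x ∈ O}
      mul_mem' := by
        rintro x y ⟨k, hx⟩ ⟨l, hy⟩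
        refine ⟨k + l, ?_⟩
        have e : g ^ (k + l) * (x * y) = (g ^ k * x) * (g ^ l * y) := by ring
        rw [e]
        exact O.mul_mem _ _ hx hy
      one_mem' := ⟨0, by rw [pow_zero, one_mul]; exact O.one_mem⟩
      add_mem' := by
        rintro x y ⟨k, hx⟩ ⟨l, hy⟩
        refine ⟨k + l, ?_⟩
        have e : g ^ (k + l) * (x + y) = g ^ l * (g ^ k * x) + g ^ k * (g ^ l * y) := by ring
        rw [e]
        exact O.add_mem _ _ (O.mul_mem _ _ (pow_mem hg.1 l) hx) (O.mul_mem _ _ (pow_mem hg.1 k) hy)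
      zero_mem' := ⟨0, by rw [mul_zero]; exact O.zero_mem⟩
      neg_mem' := by
        rintro x ⟨k, hx⟩
        exact ⟨k, by rw [mul_neg]; exact O.neg_mem _ hx⟩
      mem_or_inv_mem' := fun x => (O.mem_or_inv_mem x).imp
        (fun hx => ⟨0, by rwa [pow_zero, one_mul]⟩) (fun hx => ⟨0, by rwa [pow_zero, one_mul]⟩) }
  have hmem : ∀ x : K, x ∈ O₁ ↔ ∃ k : ℕ, g ^ k * x ∈ O := fun x => Iff.rfl
  refine ⟨O₁, fun x hx => (hmem x).mpr ⟨0, by rwa [pow_zero, one_mul]⟩, ?_, ?_⟩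
  · -- `g⁻¹ ∈ O₁ ∖ O`
    intro hEq
    have hinv : g⁻¹ ∈ O₁ := (hmem _).mpr ⟨1, by rw [pow_one, mul_inv_cancel₀ hg0]; exact O.one_mem⟩
    rw [← hEq] at hinv
    exact hg1 hinv
  · -- `h⁻¹ ∉ O₁`
    intro hT
    have hinv : h⁻¹ ∈ O₁ := by rw [hT]; exact ValuationSubring.mem_top _
    obtain ⟨k, hk'⟩ := (hmem _).mp hinv
    apply hg1
    have e : g ^ k * h⁻¹ * (h / g ^ (k + 1)) = g⁻¹ := by
      rw [pow_succ]
      field_simp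
    have hprod := O.mul_mem _ _ hk' (hk (k + 1))
    rwa [e] at hprod

/-- The same with divisibility INSIDE the ring `O` (idea-3's wording «`g ^ k ∣ h` in `O` for every `k`»): for
`g ∈ 𝔪_O` non-zero and `h ∈ O` non-zero divisible by every power of `g`, `O` has a proper coarsening.
[cite: HeinzerEtAl2015, Remark 2.4] [folklore] -/
theorem hasProperCoarsening_of_forall_pow_dvd' (O : ValuationSubring K) {g h : O}
    (hg : g ∈ maximalIdeal O) (hg0 : g ≠ 0) (h0 : h ≠ 0) (hk : ∀ k : ℕ, g ^ k ∣ h) :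
    HasProperCoarsening O := by
  have hg0' : (g : K) ≠ 0 := fun e => hg0 (Subtype.ext e)
  have h0' : (h : K) ≠ 0 := fun e => h0 (Subtype.ext e)
  refine hasProperCoarsening_of_forall_pow_dvd O ⟨g.2, (O.valuation_lt_one_iff g).mp hg⟩ hg0' h0' fun k => ?_
  obtain ⟨c, hc⟩ := hk k
  have e : ((h : O) : K) / (g : K) ^ k = (c : K) := by
    rw [div_eq_iff (pow_ne_zero k hg0'), hc]
    push_cast
    ring
  rw [e]
  exact c.2

/-- The same in VALUE form: `v g < 1`, `g ≠ 0`, `h ≠ 0` and `v h ≤ (v g) ^ k` for every `k` give a proper coarsening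
(`h / g ^ k ∈ O ⇔ v h ≤ (v g) ^ k`). [cite: HeinzerEtAl2015, Remark 2.4] [folklore] -/
theorem hasProperCoarsening_of_forall_valuation_le_pow (O : ValuationSubring K) {g h : K}
    (hgv : O.valuation g < 1) (hg0 : g ≠ 0) (h0 : h ≠ 0)
    (hv : ∀ k : ℕ, O.valuation h ≤ O.valuation g ^ k) : HasProperCoarsening O := by
  have hgO : g ∈ O := (O.valuation_le_one_iff g).mp hgv.le
  refine hasProperCoarsening_of_forall_pow_dvd O ⟨hgO, hgv⟩ hg0 h0 fun k => ?_
  have hpos : 0 < O.valuation g ^ k := pow_pos ((Valuation.pos_iff _).mpr hg0) k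
  rw [← O.valuation_le_one_iff, map_div₀, map_pow, div_le_one₀ hpos]
  exact hv k

/-- **Contrapositive under the T-line binder.** If `O` has NO proper coarsening, `g ∈ O` is non-zero of positive value
and `h ≠ 0`, then some quotient `h / g ^ k` is NOT in `O`. [cite: HeinzerEtAl2015, Remark 2.4] [folklore] -/
theorem exists_div_pow_not_mem_of_not_hasProperCoarsening (O : ValuationSubring K)
    (hnc : ¬ HasProperCoarsening O) {g h : K} (hg : g ∈ O ∧ O.valuation g < 1) (hg0 : g ≠ 0) (h0 : h ≠ 0) :
    ∃ k : ℕ, h / g ^ k ∉ O := by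
  by_contra! hall
  exact hnc (hasProperCoarsening_of_forall_pow_dvd O hg hg0 h0 hall)

/-- **Archimedean property read off `¬ HasProperCoarsening O`** (no `RankOne` structure, no `O ≠ ⊤` needed): if `O`
has no proper coarsening, `v g < 1` and `h ≠ 0`, then `(v g) ^ k < v h` for some `k`. (For `g = 0` take `k = 1`.)
Compare `SwitchingDichotomy.exists_pow_valuation_lt_of_rankOne` (via `ℝ≥0`). [cite: HeinzerEtAl2015, Remark 2.4]
[folklore] -/
theorem exists_pow_valuation_lt_of_not_hasProperCoarsening (O : ValuationSubring K)
    (hnc : ¬ HasProperCoarsening O) {g h : K} (hgv : O.valuation g < 1) (h0 : h ≠ 0) :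
    ∃ k : ℕ, O.valuation g ^ k < O.valuation h := by
  by_cases hg0 : g = 0
  · exact ⟨1, by rw [hg0, map_zero, pow_one]; exact (Valuation.pos_iff _).mpr h0⟩
  by_contra! hall
  exact hnc (hasProperCoarsening_of_forall_valuation_le_pow O hgv hg0 h0 hall)

/-! ### Tightness of the binders -/

/-- The field itself (`O = ⊤`) has no proper coarsening. [folklore] -/
theorem not_hasProperCoarsening_top : ¬ HasProperCoarsening (⊤ : ValuationSubring K) := by
  rintro ⟨O₁, hle, hne, -⟩
  exact hne (le_antisymm hle le_top)

/-- **The binder `g ≠ 0` is needed** (BINDER NOTE): WITHOUT it the dealt shape is refuted by `(O, g, h) = (K, 0, 1)` —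
`0 ∈ O`, `v 0 = 0 < 1`, `1 ≠ 0`, `1 / 0 ^ k ∈ O` for all `k`, and `K` has no proper coarsening. [folklore] -/
theorem dealtShape_needs_ne_zero :
    ∃ (O : ValuationSubring K) (g h : K), (g ∈ O ∧ O.valuation g < 1) ∧ h ≠ 0 ∧
      (∀ k : ℕ, h / g ^ k ∈ O) ∧ ¬ HasProperCoarsening O :=
  ⟨⊤, 0, 1, ⟨ValuationSubring.mem_top _, by rw [map_zero]; exact zero_lt_one⟩, one_ne_zero,
    fun _ => ValuationSubring.mem_top _, not_hasProperCoarsening_top⟩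

/-! ## §2 Run-side feeders -/

/-- **Feeder, plan-1's words** (RULING 79a): along any sequence of subrings `R i ⊆ O` of `K` (the members of a
quadratic / steered run along `O`), if `g ∈ O` is non-zero of positive value and one FIXED `h ≠ 0` has
`h / g ^ k ∈ R (i k)` for every `k` (some stage `i k`), then `O` has a proper coarsening — so under the T-line binder
`¬ HasProperCoarsening O` no such pair `(g, h)` exists along the run. [cite: HeinzerEtAl2015, Remark 2.4] [folklore] -/
theorem hasProperCoarsening_of_forall_div_pow_mem_seq (O : ValuationSubring K) (R : ℕ → Subring K)
    (hRO : ∀ i, R i ≤ O.toSubring) {g h : K} (hg : g ∈ O ∧ O.valuation g < 1) (hg0 : g ≠ 0) (h0 : h ≠ 0)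
    (hk : ∀ k : ℕ, ∃ i, h / g ^ k ∈ R i) : HasProperCoarsening O :=
  hasProperCoarsening_of_forall_pow_dvd O hg hg0 h0 fun k => by
    obtain ⟨i, hi⟩ := hk k
    exact hRO i hi

/-- **Feeder along a steered run** (the skeleton's `IsSteeredRun` supplies `IsLocalBlowupAlong O (R i) (P i) (R (i+1))`
at every stage, whence `R i ⊆ O`): `g ∈ R i₀` non-zero of positive value and one fixed `h ≠ 0` with every quotient
`h / g ^ k` in some member force a proper coarsening of `O`. [cite: HeinzerEtAl2015, Remark 2.4] [folklore] -/
theorem hasProperCoarsening_of_forall_div_pow_mem_steeredSeq (O : ValuationSubring K) (R : ℕ → Subring K)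
    (P : (i : ℕ) → Ideal (R i)) (hbl : ∀ i, IsLocalBlowupAlong O (R i) (P i) (R (i + 1)))
    {g h : K} (i₀ : ℕ) (hgR : g ∈ R i₀) (hgv : O.valuation g < 1) (hg0 : g ≠ 0) (h0 : h ≠ 0)
    (hk : ∀ k : ℕ, ∃ i, h / g ^ k ∈ R i) : HasProperCoarsening O :=
  hasProperCoarsening_of_forall_div_pow_mem_seq O R (fun i => (hbl i).1) ⟨(hbl i₀).1 hgR, hgv⟩ hg0 h0 hk

/-- **Persistent divisor along a run, idea-3's words.** Stages `j 0 < j 1 < ⋯` of a run of local blowing ups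
`R i ⊂ R (i+1)` along `P i` with respect to `O`; ONE element `g` is an exceptional parameter of the blowing up at every
stage `j k` (body of the skeleton's `IsExcParamAlong O (R (j k)) (P (j k)) g`: `g ∈ P (j k)`, `g ≠ 0`, of maximal
`O`-value on `P (j k)`, so `P (j k) · R (j k + 1) = g · R (j k + 1)`); `h ∈ R (j 0)`; and whenever the quotient
`h / g ^ k` lies in `R (j k)` it lies in the centre `P (j k)`. Then `h / g ^ k ∈ R (j k)` for every `k`.
[cite: NovacoskiSpivakovsky2014, Def. 2.11] [folklore] -/
theorem forall_div_pow_mem_of_persistentDivisor (O : ValuationSubring K) (R : ℕ → Subring K)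
    (P : (i : ℕ) → Ideal (R i)) (hbl : ∀ i, IsLocalBlowupAlong O (R i) (P i) (R (i + 1)))
    (j : ℕ → ℕ) (hj : ∀ k, j k < j (k + 1)) {g h : K}
    (hexc : ∀ k, (∃ hx : g ∈ R (j k), (⟨g, hx⟩ : R (j k)) ∈ P (j k)) ∧ g ≠ 0 ∧
      ∀ y : R (j k), y ∈ P (j k) → O.valuation (y : K) ≤ O.valuation g)
    (hh : h ∈ R (j 0))
    (hcentre : ∀ (k : ℕ) (hk : h / g ^ k ∈ R (j k)), (⟨h / g ^ k, hk⟩ : R (j k)) ∈ P (j k)) :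
    ∀ k : ℕ, h / g ^ k ∈ R (j k) := by
  -- the members increase
  have hmono : Monotone R := monotone_nat_of_le_succ fun i => (hbl i).isLocalBlowup.le
  intro k
  induction k with
  | zero => simpa using hh
  | succ k ih =>
    obtain ⟨r, hr, hr'⟩ := GeoDict.exists_mem_mul_of_isExcParamAlong (hbl (j k)) (hexc k).1 (hexc k).2.1
      (hexc k).2.2 ⟨h / g ^ k, ih⟩ (hcentre k ih)
    have hg0 : g ≠ 0 := (hexc k).2.1
    have e : h / g ^ (k + 1) = r := by
      rw [pow_succ, ← div_div, show h / g ^ k = r * g from hr', mul_div_cancel_right₀ r hg0]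
    rw [e]
    exact hmono (Nat.succ_le_of_lt (hj k)) hr

/-- **Feeder, idea-3's words: a persistent exceptional divisor with one fixed `h` whose quotients stay in the centres
forces composite rank.** In the situation of `forall_div_pow_mem_of_persistentDivisor`, if moreover `v g < 1` (the
centres lie over the centre of `O`) and `h ≠ 0`, then `HasProperCoarsening O` — the run is OUT OF THE T-LINE REGIME
`¬ HasProperCoarsening O` by rank. The exact run-side datum consumed is the clause `hcentre`.
[cite: HeinzerEtAl2015, Remark 2.4] [folklore] -/
theorem hasProperCoarsening_of_persistentDivisor (O : ValuationSubring K) (R : ℕ → Subring K)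
    (P : (i : ℕ) → Ideal (R i)) (hbl : ∀ i, IsLocalBlowupAlong O (R i) (P i) (R (i + 1)))
    (j : ℕ → ℕ) (hj : ∀ k, j k < j (k + 1)) {g h : K}
    (hexc : ∀ k, (∃ hx : g ∈ R (j k), (⟨g, hx⟩ : R (j k)) ∈ P (j k)) ∧ g ≠ 0 ∧
      ∀ y : R (j k), y ∈ P (j k) → O.valuation (y : K) ≤ O.valuation g)
    (hgv : O.valuation g < 1) (h0 : h ≠ 0) (hh : h ∈ R (j 0))
    (hcentre : ∀ (k : ℕ) (hk : h / g ^ k ∈ R (j k)), (⟨h / g ^ k, hk⟩ : R (j k)) ∈ P (j k)) :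
    HasProperCoarsening O := by
  obtain ⟨⟨hgR, -⟩, hg0, -⟩ := hexc 0
  exact hasProperCoarsening_of_forall_div_pow_mem_steeredSeq O R P hbl (j 0) hgR hgv hg0 h0 fun k =>
    ⟨j k, forall_div_pow_mem_of_persistentDivisor O R P hbl j hj hexc hh hcentre k⟩

/-! ## §3 Generalised kernel (rev 2): VARYING generators with values bounded below

res-L0-w41-idea-3, ANSWER to RULING 79 (10:31:26Z), «GENERALISED KERNEL = §1 applied to a common divisor `g₀` of the varying
generators `g_{j_i}` (exists iff `inf μ_{j_i}` is bounded below by a positive value — automatic for a recurring generator and in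
DISCRETE rank one; denied exactly by decaying-value tails)»: if the successive exceptional generators `g 0, g 1, …` all have value
AT MOST that of one fixed non-zero `g₀ ∈ 𝔪_O` (i.e. they are at least as deep as `g₀`) and one fixed `h ≠ 0` is divisible in `O`
by every product `g 0 ⋯ g (k−1)`, then `h / g₀ ^ k ∈ O` for every `k`, so `O` has a proper coarsening. -/

/-- **Common divisor of varying generators.** If `g i ≠ 0` have `v (g i) ≤ v g₀` for a fixed `g₀ ≠ 0`, and
`h / (g 0 ⋯ g (k−1)) ∈ O` for every `k`, then `h / g₀ ^ k ∈ O` for every `k` (`v h ≤ ∏_{i<k} v (g i) ≤ (v g₀) ^ k`). [folklore] -/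
theorem div_pow_mem_of_forall_div_prod_mem (O : ValuationSubring K) {g : ℕ → K} {g₀ h : K} (hg₀0 : g₀ ≠ 0)
    (hg : ∀ i, g i ≠ 0) (hle : ∀ i, O.valuation (g i) ≤ O.valuation g₀)
    (hk : ∀ k : ℕ, h / ∏ i ∈ Finset.range k, g i ∈ O) (k : ℕ) : h / g₀ ^ k ∈ O := by
  have hprod0 : ∏ i ∈ Finset.range k, g i ≠ 0 := Finset.prod_ne_zero_iff.mpr fun i _ => hg i
  have hvprod : 0 < O.valuation (∏ i ∈ Finset.range k, g i) := (Valuation.pos_iff _).mpr hprod0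
  have hvg₀ : 0 < O.valuation g₀ ^ k := pow_pos ((Valuation.pos_iff _).mpr hg₀0) k
  -- `v h ≤ ∏ v (g i) ≤ (v g₀) ^ k`
  have h1 : O.valuation h ≤ O.valuation (∏ i ∈ Finset.range k, g i) := by
    have := (O.valuation_le_one_iff _).mpr (hk k)
    rwa [map_div₀, div_le_one₀ hvprod] at this
  have h2 : O.valuation (∏ i ∈ Finset.range k, g i) ≤ O.valuation g₀ ^ k := by
    rw [map_prod]
    calc ∏ i ∈ Finset.range k, O.valuation (g i) ≤ ∏ _i ∈ Finset.range k, O.valuation g₀ :=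
          Finset.prod_le_prod' fun i _ => hle i
      _ = O.valuation g₀ ^ k := by rw [Finset.prod_const, Finset.card_range]
  rw [← O.valuation_le_one_iff, map_div₀, map_pow, div_le_one₀ hvg₀]
  exact h1.trans h2

/-- **Generalised kernel ⇒ composite rank** (idea-3's form for VARYING generators): `g₀ ∈ O` non-zero of positive value bounding
the values of the non-zero generators `g i` from above (`v (g i) ≤ v g₀`), `h ≠ 0` divisible by every product `g 0 ⋯ g (k−1)`
⇒ `HasProperCoarsening O`. With a recurring generator (`g i = g₀` for all `i`) this is `hasProperCoarsening_of_forall_pow_dvd`.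
[cite: HeinzerEtAl2015, Remark 2.4] [folklore] -/
theorem hasProperCoarsening_of_forall_div_prod_mem (O : ValuationSubring K) {g : ℕ → K} {g₀ h : K}
    (hg₀ : g₀ ∈ O ∧ O.valuation g₀ < 1) (hg₀0 : g₀ ≠ 0) (hg : ∀ i, g i ≠ 0)
    (hle : ∀ i, O.valuation (g i) ≤ O.valuation g₀) (h0 : h ≠ 0)
    (hk : ∀ k : ℕ, h / ∏ i ∈ Finset.range k, g i ∈ O) : HasProperCoarsening O :=
  hasProperCoarsening_of_forall_pow_dvd O hg₀ hg₀0 h0 (div_pow_mem_of_forall_div_prod_mem O hg₀0 hg hle hk)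

/-- **Run-side form of the generalised kernel**: along members `R i ⊆ O`, if every partial product quotient
`h / (g 0 ⋯ g (k−1))` lies in SOME member, the hypotheses of `hasProperCoarsening_of_forall_div_prod_mem` hold.
[cite: HeinzerEtAl2015, Remark 2.4] [folklore] -/
theorem hasProperCoarsening_of_forall_div_prod_mem_seq (O : ValuationSubring K) (R : ℕ → Subring K)
    (hRO : ∀ i, R i ≤ O.toSubring) {g : ℕ → K} {g₀ h : K} (hg₀ : g₀ ∈ O ∧ O.valuation g₀ < 1) (hg₀0 : g₀ ≠ 0)
    (hg : ∀ i, g i ≠ 0) (hle : ∀ i, O.valuation (g i) ≤ O.valuation g₀) (h0 : h ≠ 0)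
    (hk : ∀ k : ℕ, ∃ i, h / ∏ l ∈ Finset.range k, g l ∈ R i) : HasProperCoarsening O :=
  hasProperCoarsening_of_forall_div_prod_mem O hg₀ hg₀0 hg hle h0 fun k => by
    obtain ⟨i, hi⟩ := hk k
    exact hRO i hi

end ValuationRank

end Summit.ResolutionOfSingularities.ResolutionOfSingularities.Theorems.SwitchingDichotomy
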